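/-
Copyright (c) 2026 the pub-hodgecm-mathlib formalisation cell (harness21).  Prover seat hodgecm-mathlib-K2Liu-p11 (g6), Track B «K2-LIT»,
#184♮ = hLiu418 = `stmt-HodgeConjecture-24832`; #42S BLOCK D, row D-2, (σ-A) road, brick (an-3c) §3b (D-in)+ASSEMBLY (LEAD F0P6-plan (g16) BATCH #306 (1);
(σ-A)+block-D desk K2Liu-p25 (g4) WORDs #8–#10; briefs K2Liu-p08 (g6) `HANDOFF-D` steps 6–9, K2Liu-p09 (g9) `HANDOFF-D-assembly`).
THEOREMS ONLY (no `def`, no `instance`, no `notation`, no named-fact hypothesis, no `sorry`, default heartbeats).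
-/
import Summits.HodgeConjecture.HodgeConjecture.Theorems.K2LiuConeWordPackage          -- ★ p864773 `conePackage_of_stageLetters` (+ ★ p864878 `conePackage_total`)
import Summits.HodgeConjecture.HodgeConjecture.Theorems.K2LiuConeLowerBoundRecord     -- ★ `exists_zm_lowerBound_adicCompletion` (+ ★ p864769 `K2LiuConeChartFrames`)
import Summits.HodgeConjecture.HodgeConjecture.Theorems.K2LiuConeWittDictionary       -- ★ p864884 `hWitt_of_phaseLetters`
import HarnessLib

/-!
# Crux `HLiu418`, #42S BLOCK D, row D-2, (σ-A) brick (an-3c) §3b (D-in)+ASSEMBLY `K2LiuStageFunctionalConeWordRecord`: THE CONE-WORD PACKAGE AT A DEAD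
# NON-SPLIT BAD PLACE OF THE RECORD — every non-telescope slot of ★ p864773 BY NAME

Cell `hodgecm-mathlib`, crux item hLiu418 = `stmt-HodgeConjecture-24832` (helper lane `--supports … --as helper`, count-neutral); squad K2 ∕ K2Liu, #42S block D,
(σ-A) road.  The END of the road at one place: ★ p864773 `K2LiuConeWordPackage.conePackage_of_stageLetters` turns the cone measure's clauses, the charts, the
telescope (L1)–(L4) and the pointwise Witt letter into the five letters `SFinite ρ`, `Integrable G ρ`, `Measurable q`, `hZ`, `hcone` of the D-2 socket ★ p864553
`K2LiuLocalSWSeamOfRecordGuarded.hV_faces_of_coneWord_of_dead`.  THIS FILE applies it AT THE RECORD TYPES of a non-split bad place — `F := L⁺_v`, `w ∣ v` fixed by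
complex conjugation, `κ := Fin 2` (the `ζ`-plane), `ι₁ = ι₁′ := Fin (3+3)` (three `E_w`-coordinates, quadratic-coordinate slots `eJ, eJ′`), `d ∈ L⁺_v` NOT a square
with `δ′² = ι_w d` — and discharges BY NAME every slot that is not a telescope letter:
* the CHARTS: `hZc` := ★ `K2LiuConeChartFrames.continuous_zm`, `(c₀, hZlow)` := ★ `K2LiuConeLowerBoundRecord.exists_zm_lowerBound_adicCompletion`,
  `(A, hA, hres, hAm, hdetm)` := ★ `K2LiuConeChartFrames.exists_coneChartFrames` at the consumer's ONE slot equivalence `eA : Fin 2 ⊕ ι₂ ≃ Fin (3+3)`, `hnum` by `decide`;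
* the POINTWISE WITT LETTER: ★ p864884 `K2LiuConeWittDictionary.hWitt_of_phaseLetters` at the hermitian frame `(Ah, a)` of record, from the two PIN READINGS (2a-read)
  `hpinQ` (cone phase `Qf s` read through `sE`) and (2b-read) `hpinq` (phase value `qf (t ⊔ s)` read through `T = Ah⁻¹(σ_w ∘ τE)`) — BY VALUE in ★ p864884's binder
  bytes until (B2-coord) FILE B; class scalar `κ₂·a` (ruling #11, `κ₂` absorbed);
* `SFinite`, the product carrier, the defining letters `hGdef hqdef hγdef` by `rfl`.
BY VALUE (named letters, hypothesis-first): the OUTER telescope **`hOut`** = (D-out) ★-pending `K2LiuStageFunctionalOuterDocking.hL1_hL2_of_outerStage`'s conclusion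
(LH4-p17 (g4)): `∃ σ″ N₁ cE cF`, the four (an-1) clauses of the RESCALED cone measure `σ″` (finite on compacts, `σ″{0} = 0`, `σ″{Qf ≠ 0} = 0`, vertex law in ★ p864773's
`ℝ` form) and (L1), (L2); the INNER telescope **`hL3 hL4`** ((C) §3, F0P2-p07) in ★ p864773's bytes; the pins **`hpinQ hpinq`**.
* **`hcone_hZ_of_record`** — ⊢ `∃ ρ G q γ′`, the five socket letters at the place (`ρ := σ″ ⊗ μ^{ι₂}`,
  `R y :↔ (−y·(κ₂a)⁻¹, θ)_v = 1`); the #42S frame feeds ★ p864878 `conePackage_total` under the dead guard.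
HONEST LABEL.  Count-neutral helper, hypothesis-first in `hOut hL3 hL4 hpinQ hpinq` (payers: (D-out) LH4-p17 (g4), (C) §3 F0P2-p07 (g2), (B2-coord) FILE B
K2Liu-p12 (g7)); closes no socket: `HC_CM` is proved only modulo the 7 printed citations (2 remaining named inputs: hLiu418 = `stmt-HodgeConjecture-24832`,
h413 = `stmt-HodgeConjecture-24833`) until rung 0 closes.

## References
* [KudlaRallis1994] S. Kudla, S. Rallis, *A regularized Siegel–Weil formula: the first term identity*, Ann. of Math. 140 (1994), §2 (2.10)–(2.12), §5 (5.3)–(5.6).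
* [Weil1965] A. Weil, *Sur la formule de Siegel dans la théorie des groupes classiques*, Acta Math. 113 (1965), Chap. III n° 36–37 Prop. 6.
* [Omeara1963] O. T. O'Meara, *Introduction to Quadratic Forms* (1963), §63B (63:10).
* [MoeglinVignerasWaldspurger1987] C. Mœglin, M.-F. Vignéras, J.-L. Waldspurger, LNM 1291 (1987), Chap. 2 II.6.
-/

set_option autoImplicit false
set_option linter.dupNamespace false -- the mandated namespace repeats `HodgeConjecture.HodgeConjecture`

noncomputable section

open MeasureTheory Set Filter Function Matrix
open scoped Matrix NNReal ENNReal
open NumberField IsDedekindDomain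
open Literature.NumberTheory.Automorphic Literature.NumberTheory.Automorphic.UnitaryGroup
open Literature.NumberTheory.GaloisRepresentations Literature.NumberTheory.GaloisRepresentations.IsNonarchimedeanLocalField
open Literature.NumberTheory.QuadraticForms Literature.NumberTheory.Rogawski1990
open Literature.RepresentationTheory.HeisenbergGroup
open Literature.NumberTheory.Weil1965.SplitPlace (level)
open Summit.HodgeConjecture.HodgeConjecture.Cruxes.HLiu418

namespace Summit.HodgeConjecture.HodgeConjecture.Cruxes.HLiu418.K2LiuStageFunctionalConeWordRecord

/-- **(D-in)+ASSEMBLY — THE CONE-WORD PACKAGE AT A DEAD NON-SPLIT BAD PLACE OF THE RECORD.**  `L` CM, `v` a finite place of `L⁺`, `w ∣ v` fixed by complex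
conjugation (non-split), `F := L⁺_v` with a Haar measure `μ` and a continuous non-trivial `ψ` of conductor exponent `m`; quadratic-coordinate slots `eJ eJ′` of
`Fin (3+3)`, the consumer's slot equivalence `eA : Fin 2 ⊕ ι₂ ≃ Fin (3+3)` and block gluing `e : Fin (3+3) ⊕ Fin (3+3) ≃ ι`; `d` not a square, `δ′² = ι_w d`;
the multiplication graph `Zm` with its coordinate letter `hZm`; the hermitian frame `Ah` (`det Ah = ι_w a`, `a ≠ 0`) and the pin units `κ₁ κ₂`; the cone phase `Qf`;
BY VALUE the outer telescope `hOut` ((D-out)'s conclusion), the inner telescope `hL3 hL4` and the two pin readings `hpinQ hpinq`.  THEN there are `ρ G q γ′` with the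
five letters of ★ p864553's D-2 socket at this place, `R y :↔ (−y·(κ₂·a)⁻¹, θ)_v = 1`.
[cite: KudlaRallis1994, §2 (2.10)–(2.12)] [cite: Weil1965, Chap. III n° 36–37 Prop. 6] [cite: Omeara1963, §63B (63:10)] [cite: MoeglinVignerasWaldspurger1987, Chap. 2 II.6] -/
theorem hcone_hZ_of_record (L : Type) [Field L] [NumberField L] [IsCMField L] (v : HeightOneSpectrum (𝓞 ↥(maximalRealSubfield L)))
    (w : PlacesOver L v) (hw : IsCMField.complexConj L • w.1 = w.1)
    [MeasurableSpace (v.adicCompletion ↥(maximalRealSubfield L))] [BorelSpace (v.adicCompletion ↥(maximalRealSubfield L))]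
    (μ : Measure (v.adicCompletion ↥(maximalRealSubfield L))) [μ.IsAddHaarMeasure]
    {ψ : AddChar (v.adicCompletion ↥(maximalRealSubfield L)) Circle} (hψ : ψ.IsContinuousNontrivial) {m : ℤ} (hm : ψ.HasConductorExp m)
    -- the index data of the record
    {ι₂ ι : Type*} [Fintype ι₂] [DecidableEq ι₂] [Fintype ι]
    (e : Fin (3 + 3) ⊕ Fin (3 + 3) ≃ ι) (eA : Fin 2 ⊕ ι₂ ≃ Fin (3 + 3))
    (eJ : Fin 3 × Fin 2 ≃ Fin (3 + 3)) (eJ' : Fin 3 × Fin 2 ≃ Fin (3 + 3))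
    {d : v.adicCompletion ↥(maximalRealSubfield L)} (hd : ¬ IsSquare d) (δ' : w.1.adicCompletion L) (hδ : δ' * δ' = toPlace v w d)
    -- the multiplication graph and its coordinate letter ((an-3c-charts))
    (Zm : (Fin (3 + 3) → v.adicCompletion ↥(maximalRealSubfield L)) →
      ((Fin 2 → v.adicCompletion ↥(maximalRealSubfield L)) →ₗ[v.adicCompletion ↥(maximalRealSubfield L)] (Fin (3 + 3) → v.adicCompletion ↥(maximalRealSubfield L))))
    (hZm : ∀ (s : Fin (3 + 3) → v.adicCompletion ↥(maximalRealSubfield L)) (ζ : Fin 2 → v.adicCompletion ↥(maximalRealSubfield L)) (j : Fin 3),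
      Zm s ζ (eJ (j, 0)) = ζ 0 * s (eJ' (j, 0)) + d * ζ 1 * s (eJ' (j, 1)) ∧
      Zm s ζ (eJ (j, 1)) = ζ 0 * s (eJ' (j, 1)) + ζ 1 * s (eJ' (j, 0)))
    -- the hermitian frame of record and the pin units (ruling #11: class scalar `κ₂·a`)
    {Ah : Matrix (Fin 3) (Fin 3) (w.1.adicCompletion L)}
    (hAh : ∀ i j, galAdicCompletionMap (L := L) (IsCMField.complexConj L) hw (Ah i j) = Ah j i)
    {a : v.adicCompletion ↥(maximalRealSubfield L)} (ha : a ≠ 0) (hdetA : Ah.det = toPlace v w a)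
    {κ₁ κ₂ : v.adicCompletion ↥(maximalRealSubfield L)} (hκ₁ : κ₁ ≠ 0) (hκ₂ : κ₂ ≠ 0)
    -- the cone phase ((A) ★ `exists_quadraticForm_conePhase`) and the telescope's objects
    (Qf : QuadraticForm (v.adicCompletion ↥(maximalRealSubfield L)) (Fin (3 + 3) → v.adicCompletion ↥(maximalRealSubfield L)))
    (N₂val : v.adicCompletion ↥(maximalRealSubfield L) → ℂ)
    (V Θ : v.adicCompletion ↥(maximalRealSubfield L) → SchwartzBruhat (ι → v.adicCompletion ↥(maximalRealSubfield L)))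
    (qf : (ι → v.adicCompletion ↥(maximalRealSubfield L)) → v.adicCompletion ↥(maximalRealSubfield L)) (hqf : Continuous qf)
    (G₀ : SchwartzBruhat (ι → v.adicCompletion ↥(maximalRealSubfield L))) (γ : ℂ)
    -- (D-out) BY VALUE: the rescaled cone measure's four clauses and the outer telescope (L1), (L2) (LH4-p17 (g4) `hL1_hL2_of_outerStage`)
    (hOut : ∃ (σ : Measure (Fin (3 + 3) → v.adicCompletion ↥(maximalRealSubfield L)))
        (N₁ : v.adicCompletion ↥(maximalRealSubfield L) → (Fin 2 → v.adicCompletion ↥(maximalRealSubfield L)) → ℂ) (cE cF : ℂ),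
      IsFiniteMeasureOnCompacts σ ∧ σ {0} = 0 ∧ σ {s | Qf s ≠ 0} = 0 ∧
      (∀ n : ℤ, σ.real (piPrimePowBall (v.adicCompletion ↥(maximalRealSubfield L)) (Fin (3 + 3)) (n + 1)) =
        (((residueFieldCard (v.adicCompletion ↥(maximalRealSubfield L)) : ℝ) ^ Fintype.card (Fin (3 + 3)))⁻¹ *
          (residueFieldCard (v.adicCompletion ↥(maximalRealSubfield L)) : ℝ) ^ 2) *
          σ.real (piPrimePowBall (v.adicCompletion ↥(maximalRealSubfield L)) (Fin (3 + 3)) n)) ∧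
      (∀ x, N₂val x = cE * ∫ ζ, N₁ x ζ ∂(Measure.pi fun _ : Fin 2 => μ)) ∧
      (∀ (x : v.adicCompletion ↥(maximalRealSubfield L)) (ζ : Fin 2 → v.adicCompletion ↥(maximalRealSubfield L)),
        N₁ x ζ = cF * ∫ s, (V x : (ι → v.adicCompletion ↥(maximalRealSubfield L)) → ℂ) (glue e (Zm s ζ) s) ∂σ))
    -- (C) BY VALUE: the inner telescope (L3), (L4) in ★ p864773's bytes
    (hL3 : ∀ (x : v.adicCompletion ↥(maximalRealSubfield L)) (q₁ : Fin (3 + 3) → v.adicCompletion ↥(maximalRealSubfield L))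
        (q₂ : Fin (3 + 3) → v.adicCompletion ↥(maximalRealSubfield L)),
      (V x : (ι → v.adicCompletion ↥(maximalRealSubfield L)) → ℂ) (glue e q₁ q₂) =
        γ * ∫ t, ((ψ (t ⬝ᵥ q₁) : Circle) : ℂ) * (Θ x : (ι → v.adicCompletion ↥(maximalRealSubfield L)) → ℂ) (glue e t q₂)
          ∂(Measure.pi fun _ : Fin (3 + 3) => μ))
    (hL4 : ∀ (x : v.adicCompletion ↥(maximalRealSubfield L)) (u : ι → v.adicCompletion ↥(maximalRealSubfield L)),
      (Θ x : (ι → v.adicCompletion ↥(maximalRealSubfield L)) → ℂ) u = ((ψ (x * qf u) : Circle) : ℂ) * (G₀ : (ι → v.adicCompletion ↥(maximalRealSubfield L)) → ℂ) u)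
    -- (B2-coord) BY VALUE: the two pin readings in ★ p864884's binder bytes
    (hpinQ : ∀ (s : Fin (3 + 3) → v.adicCompletion ↥(maximalRealSubfield L)) (sE : Fin 3 → w.1.adicCompletion L),
      (∀ j, sE j = toPlace v w (s (eJ' (j, 0))) + toPlace v w (s (eJ' (j, 1))) * δ') →
      toPlace v w (Qf s) = toPlace v w κ₁ * ((galAdicCompletionMap (L := L) (IsCMField.complexConj L) hw ∘ sE) ⬝ᵥ Ah *ᵥ sE))
    (hpinq : ∀ (s t : Fin (3 + 3) → v.adicCompletion ↥(maximalRealSubfield L)) (τE T : Fin 3 → w.1.adicCompletion L),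
      (∀ j, τE j = toPlace v w (t (eJ (j, 1))) + toPlace v w (t (eJ (j, 0))) * δ') →
      T = Ah⁻¹ *ᵥ (galAdicCompletionMap (L := L) (IsCMField.complexConj L) hw ∘ τE) →
      toPlace v w (qf (glue e t s)) = toPlace v w κ₂ * ((galAdicCompletionMap (L := L) (IsCMField.complexConj L) hw ∘ T) ⬝ᵥ Ah *ᵥ T)) :
    ∃ (ρ : Measure ((Fin (3 + 3) → v.adicCompletion ↥(maximalRealSubfield L)) × (ι₂ → v.adicCompletion ↥(maximalRealSubfield L))))
      (G : (Fin (3 + 3) → v.adicCompletion ↥(maximalRealSubfield L)) × (ι₂ → v.adicCompletion ↥(maximalRealSubfield L)) → ℂ)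
      (q : (Fin (3 + 3) → v.adicCompletion ↥(maximalRealSubfield L)) × (ι₂ → v.adicCompletion ↥(maximalRealSubfield L)) → v.adicCompletion ↥(maximalRealSubfield L))
      (γ' : ℂ),
      SFinite ρ ∧ Integrable G ρ ∧ Measurable q ∧
      (∀ᵐ z ∂ρ, q z = 0 ∨
        hilbertSymbol (v.adicCompletion ↥(maximalRealSubfield L)) (-(q z * (κ₂ * a)⁻¹))
          (algebraMap ↥(maximalRealSubfield L) (v.adicCompletion ↥(maximalRealSubfield L)) (cmQuadraticGenerator L : ↥(maximalRealSubfield L))) = 1) ∧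
      ∀ x : v.adicCompletion ↥(maximalRealSubfield L), N₂val x = γ' * ∫ z, ((ψ (x * q z) : Circle) : ℂ) * G z ∂ρ := by
  classical
  -- (D-out): the rescaled cone measure with its four clauses and (L1), (L2)
  obtain ⟨σ, N₁, cE, cF, hfin, hσ0, hσQ, hlaw, hL1, hL2⟩ := hOut
  haveI := hfin
  -- the charts BY NAME ((an-3c-charts) ★ p864769 + ★ `exists_zm_lowerBound_adicCompletion`)
  have hZc := K2LiuConeChartFrames.continuous_zm eJ eJ' d Zm hZm
  obtain ⟨c₀, hZlow⟩ := K2LiuConeLowerBoundRecord.exists_zm_lowerBound_adicCompletion ↥(maximalRealSubfield L) v eJ eJ' hd Zm hZm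
  obtain ⟨A, hA, hres, hAm, hdetm⟩ := K2LiuConeChartFrames.exists_coneChartFrames eJ eJ' eA hd Zm hZm
  have hnum : Fintype.card (Fin 2) + 2 < Fintype.card (Fin (3 + 3)) := by simp only [Fintype.card_fin]; omega
  -- the pointwise Witt letter BY NAME (★ p864884 at the two pin readings)
  have hWitt : ∀ s : Fin (3 + 3) → v.adicCompletion ↥(maximalRealSubfield L), s ≠ 0 → Qf s = 0 →
      ∀ t : Fin (3 + 3) → v.adicCompletion ↥(maximalRealSubfield L), (∀ ζ : Fin 2 → v.adicCompletion ↥(maximalRealSubfield L), t ⬝ᵥ Zm s ζ = 0) →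
      qf (glue e t s) = 0 ∨
        hilbertSymbol (v.adicCompletion ↥(maximalRealSubfield L)) (-(qf (glue e t s) * (κ₂ * a)⁻¹))
          (algebraMap ↥(maximalRealSubfield L) (v.adicCompletion ↥(maximalRealSubfield L)) (cmQuadraticGenerator L : ↥(maximalRealSubfield L))) = 1 :=
    fun s hs hQ0 t horth =>
      K2LiuConeWittDictionary.hWitt_of_phaseLetters L v w hw eJ eJ' hd δ' hδ Zm hZm hAh ha hdetA hs t
        (fun j => toPlace v w (s (eJ' (j, 0))) + toPlace v w (s (eJ' (j, 1))) * δ')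
        (fun j => toPlace v w (t (eJ (j, 1))) + toPlace v w (t (eJ (j, 0))) * δ')
        (Ah⁻¹ *ᵥ (galAdicCompletionMap (L := L) (IsCMField.complexConj L) hw ∘ fun j => toPlace v w (t (eJ (j, 1))) + toPlace v w (t (eJ (j, 0))) * δ'))
        (fun _ => rfl) (fun _ => rfl) rfl horth hκ₁ hκ₂ (hpinQ s _ fun _ => rfl) (hpinq s t _ _ (fun _ => rfl) rfl) hQ0
  -- ★ p864773: the five letters on `ρ := σ ⊗ μ^{ι₂}`
  exact ⟨σ.prod (Measure.pi fun _ : ι₂ => μ), _, _, cE * cF * γ, K2LiuConeWordPackage.conePackage_of_stageLetters μ hψ hm e eA σ hσ0 (⇑Qf) hσQ hlaw Zm hZc c₀ hZlow A hA hres hAm hdetm hnum N₂val N₁ V Θ qf hqf G₀ cE cF γ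
    hL1 hL2 hL3 hL4
    (fun y => hilbertSymbol (v.adicCompletion ↥(maximalRealSubfield L)) (-(y * (κ₂ * a)⁻¹))
      (algebraMap ↥(maximalRealSubfield L) (v.adicCompletion ↥(maximalRealSubfield L)) (cmQuadraticGenerator L : ↥(maximalRealSubfield L))) = 1)
    hWitt
    (fun p => (piSelfDualConst (v.adicCompletion ↥(maximalRealSubfield L)) (Fin 2) (Measure.pi fun _ : Fin 2 => μ) m : ℂ) *
      (normAbs (v.adicCompletion ↥(maximalRealSubfield L))
        (LinearMap.det (A p.1 : (Fin (3 + 3) → v.adicCompletion ↥(maximalRealSubfield L)) →ₗ[v.adicCompletion ↥(maximalRealSubfield L)]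
          (Fin (3 + 3) → v.adicCompletion ↥(maximalRealSubfield L)))) : ℂ) *
      (G₀ : (ι → v.adicCompletion ↥(maximalRealSubfield L)) → ℂ) (glue e (A p.1 (glue eA 0 p.2)) p.1))
    (fun p => qf (glue e (A p.1 (glue eA 0 p.2)) p.1)) (cE * cF * γ) (fun _ => rfl) (fun _ => rfl) rfl⟩

end Summit.HodgeConjecture.HodgeConjecture.Cruxes.HLiu418.K2LiuStageFunctionalConeWordRecord

end
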